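import Literature.Analysis.FluidPDE.OnsagerBDSVTransportHigher
import Literature.Analysis.FluidPDE.OnsagerBDSVGluingProofs
import Literature.Analysis.FunctionSpaces.TorusLerayHelmholtz
import HarnessLib

/-!
# The BDSV gluing stage: a priori Hölder bounds for exact Euler solutions (Cor. 3.2)

Buckmaster–De Lellis–Székelyhidi–Vicol, *Onsager's conjecture for admissible weak solutions*,
CPAM 72 (2019) = arXiv:1701.08678, §3.1: the exact solutions `vᵢ` of (3.1) obey, for
`|t - tᵢ| ≤ τ_q`, `‖vᵢ‖_{N+α} ≲ ‖v_ℓ(tᵢ)‖_{N+α}` (Prop. 3.1 (3.2) with the CFL condition (2.16)′,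
proof: "Using the equation for the pressure `-Δp = ∇v·∇v` and Schauder estimates we obtain
`‖∇∂^θp‖_α ≲ ‖∇v·∇v‖_{N-1+α} ≲ ‖v‖_{1+α}‖v‖_{N+α}`. Therefore `‖(∂ₜ + v·∇)∂^θv‖_α ≲ ‖v‖_{1+α}‖v‖_{N+α}`,
and (3.2) follows by applying (B.2) and Grönwall's inequality"), whence Cor. 3.2.

This file proves that a priori estimate for **every** smooth exact Euler solution on a time
interval (not only the one produced by the local existence theorem), in dimensionless form:
given the Calderón–Zygmund bound `BDSV.holderCZBound`, `0 < α < 1` and `N̄`, there are `c > 0`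
and `C` such that for a smooth exact Euler solution `(v, p)` on `[a,b] × T³`, `t₀ ∈ [a,b]`,
`U > 0`, `Λ ≥ 1` with `‖v(t₀)‖_{N,α} ≤ U Λ^{N-1}` (`1 ≤ N ≤ N̄`) and `(b - a) U ≤ c`:
`‖v(t)‖_{N,α} ≤ C U Λ^{N-1}` for all `t ∈ [a,b]`, `1 ≤ N ≤ N̄` (`BDSV.eulerApriori`).

Ingredients (all proved here): the pressure equation of an Euler–Reynolds triple on a closed
interval, `Δp = div div R̊ - div((v·∇)v)` (`Torus.IsEulerReynoldsOn.laplacian_pressure_eq`); the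
identity `div((v·∇)v) = ∑ᵢⱼ ∂ᵢvⱼ ∂ⱼvᵢ` for divergence-free `v` (`BDSV.divergence_convect_self`)
and its Leibniz bound; the pressure-gradient bound `‖∇p‖_{N+1,α} ≤ C ‖∑∂ᵢvⱼ∂ⱼvᵢ‖_{N,α}`
(`∂ₘp = -∂ₘΔ⁻¹(∑∂ᵢvⱼ∂ⱼvᵢ)`, `BDSV.holderCZBound.partialDeriv_invLaplacian_le`); the level-`1`
bound by the continuity argument `BDSV.bootstrap_Icc` applied to
`μ(t) = ‖v(t)‖_∞ + ∑ₖ ‖∂ₖv(t)‖_{0,α}` with the `C^α` transport estimates; the higher levels by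
`BDSV.eContDiffHolderNorm_transport_higher` and absorption.

## References

* T. Buckmaster, C. De Lellis, L. Székelyhidi Jr., V. Vicol, *Onsager's conjecture for admissible
  weak solutions*, Comm. Pure Appl. Math. 72 (2019) 229–274 = arXiv:1701.08678: §3.1, Prop. 3.1
  (3.2) and its proof, Cor. 3.2.
-/

noncomputable section

open MeasureTheory Set Filter Function
open scoped NNReal ENNReal ContDiff Topology

set_option maxSynthPendingDepth 3

namespace Literature.Analysis.FluidPDE

open FunctionSpaces FunctionSpaces.Torus

/-! ## The pressure equation of an Euler–Reynolds triple on a closed time interval -/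

namespace Torus

variable {d : Type} [Fintype d] [DecidableEq d]

/-- `div ∇φ = Δφ` for smooth scalar `φ` on the torus. [folklore] -/
theorem divergence_gradient_eq_laplacian' {φ : UnitAddTorus d → ℝ} (hφ : IsSmooth φ)
    (x : UnitAddTorus d) : divergence (gradient φ) x = laplacian φ x := by
  rw [divergence, laplacian_eq_sum_partialDeriv_partialDeriv hφ]
  refine Finset.sum_congr rfl fun i _ => ?_
  congr 1
  funext y
  rw [gradient_eq_sum_partialDeriv (hφ.isContDiff (by simp)) y]
  simp [Finset.sum_apply, Pi.single_apply]

/-- The divergence of the one-sided time derivative of a jointly smooth divergence-free field on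
`[a,b] × T^d` vanishes (`∂ⱼ` commutes with `∂ₜ` on the closed slab). [folklore] -/
theorem divergence_timeDerivWithin_eq_zero {a b : ℝ} (hab : a < b)
    {v : ℝ → UnitAddTorus d → EuclideanSpace ℝ d} (hv : IsSmoothSpaceTimeOn (Icc a b) v)
    (hdiv : ∀ t ∈ Icc a b, IsDivFree (v t)) {t : ℝ} (ht : t ∈ Icc a b) (x : UnitAddTorus d) :
    divergence (timeDerivWithin (Icc a b) v t) x = 0 := by
  have hU : UniqueDiffOn ℝ (Icc a b) := uniqueDiffOn_Icc hab
  have hcoord : ∀ i, IsSmoothSpaceTimeOn (Icc a b) (fun s y => v s y i) := fun i => hv.apply i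
  have h1 : ∀ i, partialDeriv i (fun y => timeDerivWithin (Icc a b) v t y i) x =
      timeDerivWithin (Icc a b) (fun s y => partialDeriv i (fun z => v s z i) y) t x := by
    intro i
    have hci : (fun y => timeDerivWithin (Icc a b) v t y i) =
        timeDerivWithin (Icc a b) (fun s y => v s y i) t := by
      funext y
      exact (timeDerivWithin_clm_comp hv hU (EuclideanSpace.proj i : EuclideanSpace ℝ d →L[ℝ] ℝ) ht y).symm
    rw [hci, ← timeDerivWithin_partialDeriv_comm hab (hcoord i) ht i x]
  rw [divergence]
  simp_rw [h1]
  rw [← timeDerivWithin_finset_sum Finset.univ (fun i _ => (hcoord i).partialDeriv hU i) hU ht x]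
  -- the field `s ↦ div (v s)` vanishes on `[a,b]`
  unfold timeDerivWithin
  have hzero : EqOn (fun τ => ∑ i, partialDeriv i (fun z => v τ z i) x) (fun _ => (0 : ℝ)) (Icc a b) :=
    fun τ hτ => hdiv τ hτ x
  rw [derivWithin_congr hzero (hzero ht)]
  simp

/-- **The pressure equation on a closed time interval.** For a classical Euler–Reynolds triple
on `[a,b] × T^d`, `a < b`, at every time `t ∈ [a,b]` (including the endpoints, with the
one-sided time derivative): `Δp(t) = div (div R̊(t)) - div((v·∇)v)(t)` (BDSV §2.2: "the pressure is
determined by `Δp_q = div div(-v_q ⊗ v_q + R̊_q)`"). [cite: BuckmasterEtAl2018, §2.2] -/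
theorem IsEulerReynoldsOn.laplacian_pressure_eq {a b : ℝ} (hab : a < b)
    {v : ℝ → UnitAddTorus d → EuclideanSpace ℝ d} {p : ℝ → UnitAddTorus d → ℝ}
    {R : ℝ → UnitAddTorus d → d → EuclideanSpace ℝ d} (h : IsEulerReynoldsOn (Icc a b) v p R)
    {t : ℝ} (ht : t ∈ Icc a b) (x : UnitAddTorus d) :
    laplacian (p t) x =
      divergence (tensorDivergence (R t)) x - divergence (convect (v t) (v t)) x := by
  have hU : UniqueDiffOn ℝ (Icc a b) := uniqueDiffOn_Icc hab
  have hvt : IsSmooth (v t) := h.smooth_velocity.isSmooth_slice ht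
  have hpt : IsSmooth (p t) := h.smooth_pressure.isSmooth_slice ht
  have hRt : IsSmooth (R t) := h.smooth_stress.isSmooth_slice ht
  have hmom : (fun y => tensorDivergence (R t) y - convect (v t) (v t) y - gradient (p t) y) =
      timeDerivWithin (Icc a b) v t := by
    funext y
    have hm := h.momentum t ht y
    rw [← hm]
    abel
  have hdiv0 := divergence_timeDerivWithin_eq_zero hab h.smooth_velocity h.divFree ht x
  rw [← hmom] at hdiv0
  have h1 : IsContDiff 1 (tensorDivergence (R t)) := hRt.tensorDivergence.isContDiff (by simp)
  have h2 : IsContDiff 1 (convect (v t) (v t)) := (hvt.convect hvt).isContDiff (by simp)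
  have h3 : IsContDiff 1 (gradient (p t)) := hpt.gradient.isContDiff (by simp)
  have hsub : (fun y => tensorDivergence (R t) y - convect (v t) (v t) y - gradient (p t) y) =
      (tensorDivergence (R t) - convect (v t) (v t)) - gradient (p t) := rfl
  have h12 : IsContDiff 1 (tensorDivergence (R t) - convect (v t) (v t)) := h1.sub h2
  rw [hsub, FunctionSpaces.Torus.divergence_sub h12 h3,
    FunctionSpaces.Torus.divergence_sub h1 h2, divergence_gradient_eq_laplacian' hpt] at hdiv0
  linarith

end Torus

namespace BDSV

/-! ## `div((v·∇)v) = ∑ ∂ᵢvⱼ ∂ⱼvᵢ` for divergence-free fields -/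

section Quadratic

variable {d : Type} [Fintype d] [DecidableEq d]

omit [DecidableEq d] in
/-- Smooth functions on the torus are `Cᵏ` for every natural `k`. [folklore] -/
theorem isContDiff_nat_of_isSmooth {G : Type} [NormedAddCommGroup G] [NormedSpace ℝ G]
    {g : UnitAddTorus d → G} (hg : IsSmooth g) (k : ℕ) : IsContDiff k g :=
  hg.isContDiff (n := k) (by exact_mod_cast le_top)

/-- Components of the convective derivative: `((u·∇)w)ᵢ = ∑ⱼ uⱼ ∂ⱼwᵢ` for `C¹` `w`. [folklore] -/
theorem convect_apply_coord_sum {u w : UnitAddTorus d → EuclideanSpace ℝ d} (hw : IsContDiff 1 w)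
    (y : UnitAddTorus d) (i : d) :
    convect u w y i = ∑ j, u y j * partialDeriv j w y i := by
  rw [convect, fderiv_apply_eq_sum_partialDeriv hw y (u y)]
  simp only [WithLp.ofLp_sum, WithLp.ofLp_smul, Finset.sum_apply, Pi.smul_apply, smul_eq_mul]

/-- **`div((u·∇)u) = ∑ᵢⱼ ∂ᵢuⱼ ∂ⱼuᵢ`** for a smooth divergence-free field on the torus (Leibniz
rule, Schwarz, and `∑ⱼ uⱼ ∂ⱼ(div u) = 0`; the right-hand side `∇u·∇u` of the pressure equation
`-Δp = ∇v·∇v`, BDSV §3.1). [cite: BuckmasterEtAl2018, §3.1 (proof of Prop. 3.1)] -/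
theorem divergence_convect_self {u : UnitAddTorus d → EuclideanSpace ℝ d} (hu : IsSmooth u)
    (hdiv : IsDivFree u) (x : UnitAddTorus d) :
    divergence (convect u u) x = ∑ i, ∑ j, partialDeriv i u x j * partialDeriv j u x i := by
  have h1 : IsContDiff 1 u := hu.isContDiff (by simp)
  have huj : ∀ j, IsSmooth (fun y => u y j) := fun j => hu.apply j
  have hDji : ∀ j i, IsSmooth (fun y => partialDeriv j u y i) := fun j i => (hu.partialDeriv j).apply i
  -- expand the components of the convective term
  have hcomp : ∀ i, (fun y => convect u u y i) = fun y => ∑ j, u y j * partialDeriv j u y i := fun i =>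
    funext fun y => convect_apply_coord_sum h1 y i
  have hterm : ∀ i j, IsContDiff 1 (fun y => u y j * partialDeriv j u y i) := fun i j =>
    ((huj j).smul' (hDji j i)).isContDiff (by simp)
  -- differentiate
  have hdiff : ∀ i, partialDeriv i (fun y => convect u u y i) x =
      ∑ j, (u x j * partialDeriv i (fun y => partialDeriv j u y i) x +
        partialDeriv i u x j * partialDeriv j u x i) := by
    intro i
    rw [hcomp i, partialDeriv_finset_sum Finset.univ (fun j _ => hterm i j)]
    refine Finset.sum_congr rfl fun j _ => ?_
    rw [partialDeriv_mul ((huj j).isContDiff (by simp)) ((hDji j i).isContDiff (by simp)),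
      partialDeriv_apply_coord h1]
  -- the second derivatives: `∂ᵢ(∂ⱼu)ᵢ = ∂ⱼ(∂ᵢu)ᵢ`
  have hswap : ∀ i j, partialDeriv i (fun y => partialDeriv j u y i) x =
      partialDeriv j (fun y => partialDeriv i u y i) x := by
    intro i j
    rw [partialDeriv_apply_coord ((hu.partialDeriv j).isContDiff (by simp)),
      partialDeriv_comm hu i j x,
      ← partialDeriv_apply_coord ((hu.partialDeriv i).isContDiff (by simp))]
  -- `∑ᵢ ∂ⱼ(∂ᵢu)ᵢ = ∂ⱼ(div u) = 0`
  have hdiv0 : ∀ j, ∑ i, partialDeriv j (fun y => partialDeriv i u y i) x = 0 := by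
    intro j
    have hti : ∀ i, IsContDiff 1 (fun y => partialDeriv i u y i) := fun i => (hDji i i).isContDiff (by simp)
    rw [← partialDeriv_finset_sum Finset.univ (fun i _ => hti i)]
    have hfun : (fun y => ∑ i, partialDeriv i u y i) = fun _ => (0 : ℝ) := by
      funext y
      have h := hdiv y
      rw [divergence] at h
      rw [← h]
      exact Finset.sum_congr rfl fun i _ => (partialDeriv_apply_coord h1 i y i).symm
    rw [hfun]
    simp [partialDeriv, FunctionSpaces.Torus.lineDeriv]
  rw [divergence]
  simp_rw [hdiff]
  simp only [Finset.sum_add_distrib]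
  have hfirst : ∑ i, ∑ j, u x j * partialDeriv i (fun y => partialDeriv j u y i) x = 0 := by
    calc ∑ i, ∑ j, u x j * partialDeriv i (fun y => partialDeriv j u y i) x
        = ∑ i, ∑ j, u x j * partialDeriv j (fun y => partialDeriv i u y i) x :=
          Finset.sum_congr rfl fun i _ => Finset.sum_congr rfl fun j _ => by rw [hswap i j]
      _ = ∑ j, ∑ i, u x j * partialDeriv j (fun y => partialDeriv i u y i) x := Finset.sum_comm
      _ = ∑ j, u x j * ∑ i, partialDeriv j (fun y => partialDeriv i u y i) x :=
          Finset.sum_congr rfl fun j _ => (Finset.mul_sum _ _ _).symm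
      _ = 0 := Finset.sum_eq_zero fun j _ => by rw [hdiv0 j, mul_zero]
  rw [hfirst, zero_add]

/-- **Leibniz bound for `∑ᵢⱼ ∂ᵢuⱼ ∂ⱼuᵢ`**:
`‖∑ᵢⱼ ∂ᵢuⱼ∂ⱼuᵢ‖_{N,α} ≤ d² 3^N ∑_{m ≤ N} ‖u‖_{m+1,α} ‖u‖_{N-m+1,α}` (BDSV: "`‖∇v·∇v‖_{N-1+α} ≲ ‖v‖_{1+α}‖v‖_{N+α}`",
non-interpolated form). [folklore] -/
theorem eContDiffHolderNorm_gradQuad_le {u : UnitAddTorus d → EuclideanSpace ℝ d} (hu : IsSmooth u)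
    (N : ℕ) (α : ℝ≥0) :
    Torus.eContDiffHolderNorm N α (fun x => ∑ i, ∑ j, partialDeriv i u x j * partialDeriv j u x i) ≤
      (Fintype.card d) ^ 2 * 3 ^ N * ∑ m ∈ Finset.range (N + 1),
        Torus.eContDiffHolderNorm (m + 1) α u * Torus.eContDiffHolderNorm (N - m + 1) α u := by
  have hDji : ∀ j i, IsSmooth (fun y => partialDeriv j u y i) := fun j i => (hu.partialDeriv j).apply i
  set S : ℝ≥0∞ := ∑ m ∈ Finset.range (N + 1),
    Torus.eContDiffHolderNorm (m + 1) α u * Torus.eContDiffHolderNorm (N - m + 1) α u with hS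
  -- each product
  have hprod : ∀ i j, Torus.eContDiffHolderNorm N α
      (fun x => partialDeriv i u x j * partialDeriv j u x i) ≤ 3 ^ N * S := by
    intro i j
    have h := Torus.eContDiffHolderNorm_bilinear_le (ContinuousLinearMap.mul ℝ ℝ)
      ((hDji i j).isContDiff (n := N) (by exact_mod_cast le_top))
      ((hDji j i).isContDiff (n := N) (by exact_mod_cast le_top)) α
    refine h.trans ?_
    have hmul : ‖(ContinuousLinearMap.mul ℝ ℝ)‖ₑ ≤ 1 := by
      rw [← ofReal_norm, ← ENNReal.ofReal_one]
      exact ENNReal.ofReal_le_ofReal (ContinuousLinearMap.opNorm_mul_le ℝ ℝ)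
    calc 3 ^ N * ‖ContinuousLinearMap.mul ℝ ℝ‖ₑ * ∑ m ∈ Finset.range (N + 1),
          Torus.eContDiffHolderNorm m α (fun x => partialDeriv i u x j) *
            Torus.eContDiffHolderNorm (N - m) α (fun x => partialDeriv j u x i)
        ≤ 3 ^ N * 1 * S := by
          refine mul_le_mul' (mul_le_mul' le_rfl hmul) (Finset.sum_le_sum fun m hm => ?_)
          refine mul_le_mul' ?_ ?_
          · exact (eContDiffHolderNorm_coord_le (hu.partialDeriv i) m α j).trans
              (Torus.eContDiffHolderNorm_partialDeriv_le (isContDiff_nat_of_isSmooth hu (m + 1)) i α)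
          · exact (eContDiffHolderNorm_coord_le (hu.partialDeriv j) (N - m) α i).trans
              (Torus.eContDiffHolderNorm_partialDeriv_le (isContDiff_nat_of_isSmooth hu (N - m + 1)) j α)
      _ = 3 ^ N * S := by rw [mul_one]
  have hsmooth : ∀ i j, IsContDiff N (fun x => partialDeriv i u x j * partialDeriv j u x i) := fun i j =>
    ((hDji i j).smul' (hDji j i)).isContDiff (by exact_mod_cast le_top)
  have hfun : (fun x => ∑ i, ∑ j, partialDeriv i u x j * partialDeriv j u x i) =
      ∑ i, ∑ j, fun x => partialDeriv i u x j * partialDeriv j u x i := by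
    funext x
    simp only [Finset.sum_apply]
  rw [hfun]
  have hinner : ∀ i, IsContDiff N (∑ j, fun x => partialDeriv i u x j * partialDeriv j u x i) := by
    intro i
    have h : (∑ j, fun x => partialDeriv i u x j * partialDeriv j u x i) =
        fun x => ∑ j, partialDeriv i u x j * partialDeriv j u x i := by
      funext x; simp only [Finset.sum_apply]
    rw [h]
    exact ContDiff.sum fun j _ => hsmooth i j
  calc Torus.eContDiffHolderNorm N α (∑ i, ∑ j, fun x => partialDeriv i u x j * partialDeriv j u x i)
      ≤ ∑ i, Torus.eContDiffHolderNorm N α (∑ j, fun x => partialDeriv i u x j * partialDeriv j u x i) :=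
        Torus.eContDiffHolderNorm_sum_le Finset.univ fun i _ => hinner i
    _ ≤ ∑ i, ∑ j, Torus.eContDiffHolderNorm N α (fun x => partialDeriv i u x j * partialDeriv j u x i) :=
        Finset.sum_le_sum fun i _ => Torus.eContDiffHolderNorm_sum_le Finset.univ fun j _ => hsmooth i j
    _ ≤ ∑ _i : d, ∑ _j : d, 3 ^ N * S := Finset.sum_le_sum fun i _ => Finset.sum_le_sum fun j _ => hprod i j
    _ = (Fintype.card d) ^ 2 * 3 ^ N * S := by
        simp only [Finset.sum_const, Finset.card_univ, nsmul_eq_mul]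
        ring

end Quadratic

/-! ## The pressure gradient of an exact Euler solution -/

section Pressure

/-- `‖∇θ‖_{k,α} ≤ ∑ₘ ‖∂ₘθ‖_{k,α}` for smooth scalar `θ` on `T^d` (`∇θ = ∑ₘ ∂ₘθ eₘ`). [folklore] -/
theorem eContDiffHolderNorm_gradient_le_sum {d : Type} [Fintype d] [DecidableEq d]
    {θ : UnitAddTorus d → ℝ} (hθ : IsSmooth θ) (k : ℕ) (α : ℝ≥0) :
    Torus.eContDiffHolderNorm k α (gradient θ) ≤ ∑ m, Torus.eContDiffHolderNorm k α (partialDeriv m θ) := by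
  set L : d → (ℝ →L[ℝ] EuclideanSpace ℝ d) := fun m =>
    (ContinuousLinearMap.id ℝ ℝ).smulRight (EuclideanSpace.single m (1 : ℝ)) with hL
  have hrepr : gradient θ = ∑ m, fun x => L m (partialDeriv m θ x) := by
    funext x
    rw [gradient_eq_sum_partialDeriv (hθ.isContDiff (by simp)) x, Finset.sum_apply]
    refine Finset.sum_congr rfl fun m _ => ?_
    simp [hL]
  have hsm : ∀ m, IsContDiff k (fun x => L m (partialDeriv m θ x)) := fun m =>
    ((hθ.partialDeriv m).comp_clm (L m)).isContDiff (by exact_mod_cast le_top)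
  rw [hrepr]
  refine (Torus.eContDiffHolderNorm_sum_le Finset.univ fun m _ => hsm m).trans
    (Finset.sum_le_sum fun m _ => ?_)
  refine (Torus.eContDiffHolderNorm_clm_comp_le (L m)
    ((hθ.partialDeriv m).isContDiff (by exact_mod_cast le_top)) α).trans ?_
  have h1 : ‖L m‖ₑ ≤ 1 := by
    rw [← ofReal_norm, ← ENNReal.ofReal_one]
    exact ENNReal.ofReal_le_ofReal (norm_smulRight_single_le m)
  calc ‖L m‖ₑ * Torus.eContDiffHolderNorm k α (partialDeriv m θ)
      ≤ 1 * Torus.eContDiffHolderNorm k α (partialDeriv m θ) := mul_le_mul' h1 le_rfl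
    _ = _ := one_mul _

/-- **The pressure of an exact Euler solution**: `p(t) = -Δ⁻¹(∑ᵢⱼ ∂ᵢvⱼ∂ⱼvᵢ)(t)` on `[a,b] × T³`
(zero-mean pressure, `Δp = -div((v·∇)v) = -∑∂ᵢvⱼ∂ⱼvᵢ`). [cite: BuckmasterEtAl2018, §3.1 ("the equation for the pressure `-Δp = ∇v·∇v`")] -/
theorem IsExactEulerOn.pressure_eq {a b : ℝ} (hab : a < b)
    {v : ℝ → UnitAddTorus (Fin 3) → EuclideanSpace ℝ (Fin 3)} {p : ℝ → UnitAddTorus (Fin 3) → ℝ}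
    (h : IsExactEulerOn (Icc a b) v p) {t : ℝ} (ht : t ∈ Icc a b) :
    p t = -invLaplacian (fun x => ∑ i, ∑ j, partialDeriv i (v t) x j * partialDeriv j (v t) x i) := by
  have hvt : IsSmooth (v t) := h.smooth_velocity.isSmooth_slice ht
  have hpt : IsSmooth (p t) := h.smooth_pressure.isSmooth_slice ht
  have hR0 : Torus.tensorDivergence (fun (_ : UnitAddTorus (Fin 3)) (_ : Fin 3) =>
      (0 : EuclideanSpace ℝ (Fin 3))) = fun _ => 0 := funext fun x => Torus.tensorDivergence_zero x
  have hlap : laplacian (p t) = -fun x => ∑ i, ∑ j, partialDeriv i (v t) x j * partialDeriv j (v t) x i := by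
    funext x
    rw [Torus.IsEulerReynoldsOn.laplacian_pressure_eq hab h ht x, Pi.neg_apply,
      divergence_convect_self hvt (h.divFree t ht) x, hR0, Torus.divergence_zero, zero_sub]
  have hQ : IsSmooth (fun x => ∑ i, ∑ j, partialDeriv i (v t) x j * partialDeriv j (v t) x i) := by
    have : (fun x => ∑ i, ∑ j, partialDeriv i (v t) x j * partialDeriv j (v t) x i) = -laplacian (p t) := by
      rw [hlap, neg_neg]
    rw [this]
    exact hpt.laplacian.neg
  calc p t = invLaplacian (laplacian (p t)) :=
        (invLaplacian_laplacian_of_integral_eq_zero hpt (h.hasZeroMean_pressure t ht)).symm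
    _ = -invLaplacian (fun x => ∑ i, ∑ j, partialDeriv i (v t) x j * partialDeriv j (v t) x i) := by
        rw [hlap, invLaplacian_neg hQ]

/-- **Pressure-gradient bound for exact Euler solutions** (BDSV §3.1: "Using the equation for
the pressure `-Δp = ∇v·∇v` and Schauder estimates we obtain `‖∇∂^θp‖_α ≲ ‖∇v·∇v‖_{N-1+α}`"): from
`BDSV.holderCZBound`, for `0 < α < 1` and `N` there is `C` with
`‖∇p(t)‖_{N+1,α} ≤ C ∑_{m ≤ N} ‖v(t)‖_{m+1,α} ‖v(t)‖_{N-m+1,α}` for every smooth exact Euler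
solution on `[a,b] × T³` and `t ∈ [a,b]`. [cite: BuckmasterEtAl2018, §3.1 (proof of Prop. 3.1)] -/
theorem holderCZBound.gradient_pressure_le (hCZ : holderCZBound) {α : ℝ≥0} (hα : 0 < α)
    (hα1 : α < 1) (N : ℕ) :
    ∃ C : ℝ≥0, ∀ {a b : ℝ}, a < b →
      ∀ {v : ℝ → UnitAddTorus (Fin 3) → EuclideanSpace ℝ (Fin 3)} {p : ℝ → UnitAddTorus (Fin 3) → ℝ},
        IsExactEulerOn (Icc a b) v p → ∀ t ∈ Icc a b,
          Torus.eContDiffHolderNorm (N + 1) α (gradient (p t)) ≤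
            C * ∑ m ∈ Finset.range (N + 1), Torus.eContDiffHolderNorm (m + 1) α (v t) *
              Torus.eContDiffHolderNorm (N - m + 1) α (v t) := by
  obtain ⟨C, hC⟩ := hCZ.partialDeriv_invLaplacian_le hα hα1 N
  refine ⟨3 * C * (9 * 3 ^ N), fun hab v p h t ht => ?_⟩
  have hvt : IsSmooth (v t) := h.smooth_velocity.isSmooth_slice ht
  have hpt : IsSmooth (p t) := h.smooth_pressure.isSmooth_slice ht
  set Q : UnitAddTorus (Fin 3) → ℝ := fun x => ∑ i, ∑ j, partialDeriv i (v t) x j * partialDeriv j (v t) x i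
    with hQdef
  have hpQ : p t = -invLaplacian Q := IsExactEulerOn.pressure_eq hab h ht
  have hQ : IsSmooth Q := by
    have hR0 : Torus.tensorDivergence (fun (_ : UnitAddTorus (Fin 3)) (_ : Fin 3) =>
        (0 : EuclideanSpace ℝ (Fin 3))) = fun _ => 0 := funext fun x => Torus.tensorDivergence_zero x
    have : Q = -laplacian (p t) := by
      have h1 : laplacian (p t) = -Q := by
        funext x
        rw [Torus.IsEulerReynoldsOn.laplacian_pressure_eq hab h ht x, Pi.neg_apply,
          divergence_convect_self hvt (h.divFree t ht) x, hR0, Torus.divergence_zero, zero_sub]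
      rw [h1, neg_neg]
    rw [this]
    exact hpt.laplacian.neg
  set S : ℝ≥0∞ := ∑ m ∈ Finset.range (N + 1), Torus.eContDiffHolderNorm (m + 1) α (v t) *
    Torus.eContDiffHolderNorm (N - m + 1) α (v t) with hSdef
  have hQS : Torus.eContDiffHolderNorm N α Q ≤ 9 * 3 ^ N * S := by
    have h := eContDiffHolderNorm_gradQuad_le hvt N α
    rw [Fintype.card_fin] at h
    refine h.trans (le_of_eq ?_)
    push_cast
    ring
  have hpm : ∀ m, Torus.eContDiffHolderNorm (N + 1) α (partialDeriv m (p t)) ≤ C * (9 * 3 ^ N * S) := by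
    intro m
    have h1 : partialDeriv m (p t) = -partialDeriv m (invLaplacian Q) := by
      funext x
      rw [hpQ, Pi.neg_apply, ← partialDeriv_neg m (invLaplacian Q) x]
      rfl
    rw [h1, Torus.eContDiffHolderNorm_neg]
    exact (hC m Q hQ).trans (mul_le_mul' le_rfl hQS)
  calc Torus.eContDiffHolderNorm (N + 1) α (gradient (p t))
      ≤ ∑ m, Torus.eContDiffHolderNorm (N + 1) α (partialDeriv m (p t)) :=
        eContDiffHolderNorm_gradient_le_sum hpt (N + 1) α
    _ ≤ ∑ _m : Fin 3, (C : ℝ≥0∞) * (9 * 3 ^ N * S) := Finset.sum_le_sum fun m _ => hpm m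
    _ = ((3 * C * (9 * 3 ^ N) : ℝ≥0) : ℝ≥0∞) * S := by
        simp only [Finset.sum_const, Finset.card_univ, Fintype.card_fin, nsmul_eq_mul]
        push_cast
        ring

end Pressure

/-! ## The level-`1` bound: the continuity argument -/

section LevelOne

/-- `e^{x} ≤ 3/2` for `0 ≤ x ≤ 1/4`. [folklore] -/
theorem exp_le_three_halves {x : ℝ} (h0 : 0 ≤ x) (h1 : x ≤ 1 / 4) : Real.exp x ≤ 3 / 2 := by
  have h := Real.abs_exp_sub_one_sub_id_le (x := x) (by rw [abs_of_nonneg h0]; linarith)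
  have h2 : Real.exp x - 1 - x ≤ x ^ 2 := le_trans (le_abs_self _) h
  nlinarith

/-- Real form of `‖Dw‖ ≤ ‖w‖_{1,α}`: a bound `‖w‖_{1,α} ≤ W` gives `‖Dw(x)‖ ≤ W`. [folklore] -/
theorem norm_fderiv_le_of_eContDiffHolderNorm_one_le {d : Type} [Fintype d] {Y : Type}
    [NormedAddCommGroup Y] [NormedSpace ℝ Y] {w : UnitAddTorus d → Y} {α : ℝ≥0} {W : ℝ} (hW : 0 ≤ W)
    (h : Torus.eContDiffHolderNorm 1 α w ≤ ENNReal.ofReal W) (x : UnitAddTorus d) :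
    ‖Torus.fderiv w x‖ ≤ W := by
  have h1 : ‖Torus.fderiv w x‖ₑ ≤ ENNReal.ofReal W :=
    (enorm_le_eSupNorm _ x).trans ((Torus.eSupNorm_le_eContDiffHolderNorm 0 α _).trans
      ((Torus.eContDiffHolderNorm_fderiv_le 0 α w).trans h))
  rw [← ofReal_norm] at h1
  exact (ENNReal.ofReal_le_ofReal_iff hW).1 h1

/-- The transport form of the Euler momentum equation: `∂ₜv + (v·∇)v = -∇p` for an exact Euler
solution on `[a,b] × T³`. [cite: BuckmasterEtAl2018, §3.1 (3.1)] -/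
theorem IsExactEulerOn.transport_eq {a b : ℝ}
    {v : ℝ → UnitAddTorus (Fin 3) → EuclideanSpace ℝ (Fin 3)} {p : ℝ → UnitAddTorus (Fin 3) → ℝ}
    (h : IsExactEulerOn (Icc a b) v p) :
    ∀ s ∈ Icc a b, ∀ x, timeDerivWithin (Icc a b) v s x + convect (v s) (v s) x = -gradient (p s) x := by
  intro s hs x
  have hm := h.momentum s hs x
  rw [Torus.tensorDivergence_zero] at hm
  rw [← sub_eq_zero, sub_neg_eq_add, hm]

/-- **One step of the level-`1` a priori estimate.** From `BDSV.holderCZBound` and `0 < α < 1`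
there is `P` such that: for a smooth exact Euler solution on `[a,b] × T³` with
`‖v(s)‖_{1,α} ≤ W` on `[a,b]` and `W (b - a) ≤ 1/4`, and `s₀ ∈ [a,b]` with
`μ(s₀) ≤ m₀`, `μ(s) := ‖v(s)‖_∞ + ∑ₖ ‖∂ₖv(s)‖_{0,α}`, one has
`μ(s) ≤ (3/2) m₀ + (b - a) P W²` on `[a,b]` (the `C⁰` and `C^{0,α}` transport estimates for `v`
and the `∂ₖv`, the forcing `-∇p`, `-∂ₖ∇p - (∂ₖv·∇)v` being `≲ W²` by the pressure bound).
[cite: BuckmasterEtAl2018, §3.1 (proof of Prop. 3.1)] -/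
theorem holderCZBound.levelOne_step (hCZ : holderCZBound) {α : ℝ≥0} (hα : 0 < α) (hα1 : α < 1) :
    ∃ P : ℝ, 0 ≤ P ∧ ∀ {a b : ℝ} (_ : a < b)
      {v : ℝ → UnitAddTorus (Fin 3) → EuclideanSpace ℝ (Fin 3)} {p : ℝ → UnitAddTorus (Fin 3) → ℝ}
      (_ : IsExactEulerOn (Icc a b) v p) {W : ℝ} (_ : 0 ≤ W)
      (_ : ∀ s ∈ Icc a b, Torus.eContDiffHolderNorm 1 α (v s) ≤ ENNReal.ofReal W)
      (_ : W * (b - a) ≤ 1 / 4) {s₀ : ℝ} (_ : s₀ ∈ Icc a b) {m₀ : ℝ} (_ : 0 ≤ m₀)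
      (_ : eSupNorm (v s₀) + ∑ k, Torus.eContDiffHolderNorm 0 α (partialDeriv k (v s₀)) ≤
        ENNReal.ofReal m₀),
      ∀ s ∈ Icc a b, eSupNorm (v s) + ∑ k, Torus.eContDiffHolderNorm 0 α (partialDeriv k (v s)) ≤
        ENNReal.ofReal (3 / 2 * m₀ + (b - a) * P * W ^ 2) := by
  obtain ⟨C₀, hC₀⟩ := hCZ.gradient_pressure_le hα hα1 0
  refine ⟨C₀ + 9 * (C₀ + 1), by positivity, ?_⟩
  intro a b hab v p h W hW hvW hWL s₀ hs₀ m₀ hm₀ hμ₀ s hs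
  have hL : 0 < b - a := sub_pos.2 hab
  set L := b - a with hLdef
  have hU : UniqueDiffOn ℝ (Icc a b) := uniqueDiffOn_Icc hab
  have hvs : ∀ s ∈ Icc a b, IsSmooth (v s) := fun s hs => h.smooth_velocity.isSmooth_slice hs
  have hps : ∀ s ∈ Icc a b, IsSmooth (p s) := fun s hs => h.smooth_pressure.isSmooth_slice hs
  -- the forcing `G = -∇p` and its bound
  set G : ℝ → UnitAddTorus (Fin 3) → EuclideanSpace ℝ (Fin 3) := fun s x => -gradient (p s) x with hGdef
  have hG : IsSmoothSpaceTimeOn (Icc a b) G := (h.smooth_pressure.gradient hU).neg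
  have heq := IsExactEulerOn.transport_eq h
  have hGb : ∀ s ∈ Icc a b, Torus.eContDiffHolderNorm 1 α (G s) ≤ ENNReal.ofReal (C₀ * W ^ 2) := by
    intro s hs
    have hGs : G s = -gradient (p s) := rfl
    rw [hGs, Torus.eContDiffHolderNorm_neg]
    refine (hC₀ hab h s hs).trans ?_
    rw [Finset.sum_range_one, Nat.sub_zero, zero_add, ENNReal.ofReal_mul (NNReal.coe_nonneg C₀),
      ENNReal.ofReal_coe_nnreal, sq, ENNReal.ofReal_mul hW]
    exact mul_le_mul' le_rfl (mul_le_mul' (hvW s hs) (hvW s hs))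
  -- velocity gradient bound
  have hK : ∀ s ∈ Icc a b, ∀ x, ‖Torus.fderiv (v s) x‖ ≤ (⟨W, hW⟩ : ℝ≥0) := fun s hs x =>
    norm_fderiv_le_of_eContDiffHolderNorm_one_le hW (hvW s hs) x
  -- the datum pieces are finite
  have hμT : eSupNorm (v s₀) + ∑ k, Torus.eContDiffHolderNorm 0 α (partialDeriv k (v s₀)) ≠ ⊤ :=
    ne_top_of_le_ne_top ENNReal.ofReal_ne_top hμ₀
  have hE₀T : eSupNorm (v s₀) ≠ ⊤ := ne_top_of_le_ne_top hμT le_self_add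
  have hAT : ∀ k, Torus.eContDiffHolderNorm 0 α (partialDeriv k (v s₀)) ≠ ⊤ := fun k =>
    ne_top_of_le_ne_top hμT ((Finset.single_le_sum (f := fun k =>
      Torus.eContDiffHolderNorm 0 α (partialDeriv k (v s₀))) (fun _ _ => bot_le)
      (Finset.mem_univ k)).trans le_add_self)
  set E₀ : ℝ := (eSupNorm (v s₀)).toReal with hE₀
  set A : Fin 3 → ℝ := fun k => (Torus.eContDiffHolderNorm 0 α (partialDeriv k (v s₀))).toReal with hA
  have hE₀0 : 0 ≤ E₀ := ENNReal.toReal_nonneg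
  have hA0 : ∀ k, 0 ≤ A k := fun k => ENNReal.toReal_nonneg
  have hsum : E₀ + ∑ k, A k ≤ m₀ := by
    have h1 : (eSupNorm (v s₀) + ∑ k, Torus.eContDiffHolderNorm 0 α (partialDeriv k (v s₀))).toReal ≤ m₀ :=
      ENNReal.toReal_le_of_le_ofReal hm₀ hμ₀
    rwa [ENNReal.toReal_add hE₀T (ENNReal.sum_ne_top.2 fun k _ => hAT k),
      ENNReal.toReal_sum fun k _ => hAT k] at h1
  -- (i) the sup norm of `v`
  have hst : |s - s₀| ≤ L := by
    rw [abs_sub_le_iff]; constructor <;> linarith [hs.1, hs.2, hs₀.1, hs₀.2]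
  have h1 : eSupNorm (v s) ≤ ENNReal.ofReal (E₀ + L * (C₀ * W ^ 2)) := by
    have h := Torus.eSupNorm_transport_le hab h.smooth_velocity h.smooth_velocity heq hK hs₀ hs
    refine h.trans ?_
    have hsupG : (⨆ s' ∈ uIcc s₀ s, eSupNorm (G s')) ≤ ENNReal.ofReal (C₀ * W ^ 2) :=
      iSup₂_le fun s' hs' => (Torus.eSupNorm_le_eContDiffHolderNorm 1 α _).trans
        (hGb s' (uIcc_subset_Icc hs₀ hs hs'))
    calc eSupNorm (v s₀) + ENNReal.ofReal |s - s₀| * ⨆ s' ∈ uIcc s₀ s, eSupNorm (G s')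
        ≤ ENNReal.ofReal E₀ + ENNReal.ofReal L * ENNReal.ofReal (C₀ * W ^ 2) := by
          refine add_le_add (le_of_eq (ENNReal.ofReal_toReal hE₀T).symm) ?_
          exact mul_le_mul' (ENNReal.ofReal_le_ofReal hst) hsupG
      _ = ENNReal.ofReal (E₀ + L * (C₀ * W ^ 2)) := by
          rw [← ENNReal.ofReal_mul hL.le, ← ENNReal.ofReal_add hE₀0 (by positivity)]
  -- (ii) the `C^{0,α}` norms of the `∂ₖv`
  have h2 : ∀ k, Torus.eContDiffHolderNorm 0 α (partialDeriv k (v s)) ≤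
      ENNReal.ofReal (3 / 2 * (A k + 2 * L * ((C₀ + 1) * W ^ 2))) := by
    intro k
    set Fk : ℝ → UnitAddTorus (Fin 3) → EuclideanSpace ℝ (Fin 3) := fun t => partialDeriv k (v t) with hFk
    set Gk : ℝ → UnitAddTorus (Fin 3) → EuclideanSpace ℝ (Fin 3) := fun t x =>
      partialDeriv k (G t) x - convect (partialDeriv k (v t)) (v t) x with hGk
    have hFk' : IsSmoothSpaceTimeOn (Icc a b) Fk := h.smooth_velocity.partialDeriv hU k
    have heqk : ∀ s ∈ Icc a b, ∀ x,
        timeDerivWithin (Icc a b) Fk s x + convect (v s) (Fk s) x = Gk s x :=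
      fun s hs x => transport_partialDeriv hab h.smooth_velocity h.smooth_velocity heq k hs x
    -- forcing bound
    have hGk' : ∀ s' ∈ uIcc s₀ s, Torus.eContDiffHolderNorm 0 α (Gk s') ≤
        ENNReal.ofReal ((C₀ + 1) * W ^ 2) := by
      intro s' hs'
      have hs'J : s' ∈ Icc a b := uIcc_subset_Icc hs₀ hs hs'
      have hvs' := hvs s' hs'J
      have hGs' : IsSmooth (G s') := hG.isSmooth_slice hs'J
      have hp1 : Torus.eContDiffHolderNorm 0 α (partialDeriv k (G s')) ≤ ENNReal.ofReal (C₀ * W ^ 2) :=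
        (Torus.eContDiffHolderNorm_partialDeriv_le (isContDiff_nat_of_isSmooth hGs' 1) k α).trans
          (hGb s' hs'J)
      have hp2 : Torus.eContDiffHolderNorm 0 α (convect (partialDeriv k (v s')) (v s')) ≤
          ENNReal.ofReal (W ^ 2) := by
        have hc := Torus.eContDiffHolderNorm_convect_le (u := partialDeriv k (v s')) (v := v s')
          (isContDiff_nat_of_isSmooth (hvs'.partialDeriv k) 0) (isContDiff_nat_of_isSmooth hvs' 1) α (k := 0)
        refine hc.trans ?_
        rw [pow_zero, one_mul, Finset.sum_range_one, Nat.sub_zero, zero_add, sq, ENNReal.ofReal_mul hW]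
        exact mul_le_mul' ((Torus.eContDiffHolderNorm_partialDeriv_le
          (isContDiff_nat_of_isSmooth hvs' 1) k α).trans (hvW s' hs'J)) (hvW s' hs'J)
      have hsub : IsContDiff 0 (partialDeriv k (G s')) := isContDiff_nat_of_isSmooth (hGs'.partialDeriv k) 0
      have hconv : IsContDiff 0 (convect (partialDeriv k (v s')) (v s')) :=
        isContDiff_nat_of_isSmooth ((hvs'.partialDeriv k).convect hvs') 0
      have hGk_eq : Gk s' = partialDeriv k (G s') - convect (partialDeriv k (v s')) (v s') := rfl
      rw [hGk_eq]
      refine (Torus.eContDiffHolderNorm_sub_le hsub hconv).trans ?_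
      rw [add_mul, one_mul, ENNReal.ofReal_add (by positivity) (by positivity)]
      exact add_le_add hp1 hp2
    have hAk : Torus.eContDiffHolderNorm 0 α (Fk s₀) ≤ ENNReal.ofReal (A k) :=
      le_of_eq (ENNReal.ofReal_toReal (hAT k)).symm
    have h := Torus.eContDiffHolderNorm_transport_le hab h.smooth_velocity hFk' heqk hK hs₀ hs
      (hA0 k) (by positivity) hAk hGk'
    refine h.trans (ENNReal.ofReal_le_ofReal ?_)
    have hexp : Real.exp (α * (⟨W, hW⟩ : ℝ≥0) * |s - s₀|) ≤ 3 / 2 := by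
      have hα0 : (0 : ℝ) ≤ α := α.2
      have hαle : (α : ℝ) ≤ 1 := by exact_mod_cast hα1.le
      refine exp_le_three_halves (by positivity) ?_
      calc (α : ℝ) * (⟨W, hW⟩ : ℝ≥0) * |s - s₀| = α * (W * |s - s₀|) := by simp [mul_assoc]
        _ ≤ 1 * (W * L) :=
            mul_le_mul hαle (mul_le_mul_of_nonneg_left hst hW) (by positivity) zero_le_one
        _ ≤ 1 / 4 := by linarith
    have hin : 0 ≤ A k + 2 * |s - s₀| * ((C₀ + 1) * W ^ 2) := by positivity
    have hmono : A k + 2 * |s - s₀| * ((C₀ + 1) * W ^ 2) ≤ A k + 2 * L * ((C₀ + 1) * W ^ 2) := by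
      nlinarith [mul_nonneg (by positivity : (0 : ℝ) ≤ (C₀ + 1) * W ^ 2) (sub_nonneg.2 hst)]
    exact mul_le_mul hexp hmono hin (by norm_num)
  -- assemble
  calc eSupNorm (v s) + ∑ k, Torus.eContDiffHolderNorm 0 α (partialDeriv k (v s))
      ≤ ENNReal.ofReal (E₀ + L * (C₀ * W ^ 2)) +
          ∑ k, ENNReal.ofReal (3 / 2 * (A k + 2 * L * ((C₀ + 1) * W ^ 2))) :=
        add_le_add h1 (Finset.sum_le_sum fun k _ => h2 k)
    _ = ENNReal.ofReal (E₀ + L * (C₀ * W ^ 2) + ∑ k, 3 / 2 * (A k + 2 * L * ((C₀ + 1) * W ^ 2))) := by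
        rw [ENNReal.ofReal_add (by positivity) (Finset.sum_nonneg fun k _ => by
          have := hA0 k; positivity), ENNReal.ofReal_sum_of_nonneg fun k _ => by have := hA0 k; positivity]
    _ ≤ ENNReal.ofReal (3 / 2 * m₀ + L * (C₀ + 9 * (C₀ + 1)) * W ^ 2) := by
        refine ENNReal.ofReal_le_ofReal ?_
        have hS : ∑ k : Fin 3, 3 / 2 * (A k + 2 * L * ((C₀ + 1) * W ^ 2)) =
            3 / 2 * (∑ k, A k) + 9 * L * ((C₀ + 1) * W ^ 2) := by
          rw [← Finset.mul_sum, Finset.sum_add_distrib, Finset.sum_const, Finset.card_univ,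
            Fintype.card_fin]
          simp only [nsmul_eq_mul, Nat.cast_ofNat]
          ring
        rw [hS]
        have hS0 : 0 ≤ ∑ k, A k := Finset.sum_nonneg fun k _ => hA0 k
        nlinarith [hsum, hE₀0, hS0]

/-- **The level-`1` a priori bound** (BDSV Prop. 3.1 (3.2) for `N = 1`, for every smooth exact
Euler solution): from `BDSV.holderCZBound` and `0 < α < 1` there is `c > 0` such that, if
`‖v(t₀)‖_{1,α} ≤ U` and `(b - a) U ≤ c`, then `‖v(t)‖_{1,α} ≤ 8U` on `[a,b]` (continuity
argument `BDSV.bootstrap_Icc` on `μ = ‖v‖_∞ + ∑ₖ‖∂ₖv‖_{0,α}`, with `BDSV.holderCZBound.levelOne_step`).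
[cite: BuckmasterEtAl2018, Prop. 3.1 (3.2) and Cor. 3.2] -/
theorem holderCZBound.eulerApriori_one (hCZ : holderCZBound) {α : ℝ≥0} (hα : 0 < α) (hα1 : α < 1) :
    ∃ c : ℝ, 0 < c ∧ ∀ {a b : ℝ} (_ : a < b)
      {v : ℝ → UnitAddTorus (Fin 3) → EuclideanSpace ℝ (Fin 3)} {p : ℝ → UnitAddTorus (Fin 3) → ℝ}
      (_ : IsExactEulerOn (Icc a b) v p) {t₀ : ℝ} (_ : t₀ ∈ Icc a b) {U : ℝ} (_ : 0 < U)
      (_ : Torus.eContDiffHolderNorm 1 α (v t₀) ≤ ENNReal.ofReal U) (_ : (b - a) * U ≤ c),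
      ∀ t ∈ Icc a b, Torus.eContDiffHolderNorm 1 α (v t) ≤ ENNReal.ofReal (8 * U) := by
  obtain ⟨P, hP0, hstep⟩ := hCZ.levelOne_step hα hα1
  refine ⟨min (1 / 64) (1 / (128 * P + 1)), lt_min (by norm_num) (by positivity), ?_⟩
  intro a b hab v p h t₀ ht₀ U hU hvU hc
  have hc1 : (b - a) * U ≤ 1 / 64 := hc.trans (min_le_left _ _)
  have hc2 : (b - a) * U ≤ 1 / (128 * P + 1) := hc.trans (min_le_right _ _)
  have hvs : ∀ s ∈ Icc a b, IsSmooth (v s) := fun s hs => h.smooth_velocity.isSmooth_slice hs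
  -- the bootstrap quantity
  set μ : ℝ → ℝ≥0∞ := fun s => eSupNorm (v s) + ∑ k, Torus.eContDiffHolderNorm 0 α (partialDeriv k (v s))
    with hμdef
  have hF1 : ∀ s ∈ Icc a b, Torus.eContDiffHolderNorm 1 α (v s) ≤ μ s := fun s hs =>
    eContDiffHolderNorm_succ_le_sum (hvs s hs) 0 α
  have hF2 : ∀ s ∈ Icc a b, μ s ≤ 4 * Torus.eContDiffHolderNorm 1 α (v s) := by
    intro s hs
    have h1 : eSupNorm (v s) ≤ Torus.eContDiffHolderNorm 1 α (v s) := Torus.eSupNorm_le_eContDiffHolderNorm 1 α _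
    have h2 : ∀ k, Torus.eContDiffHolderNorm 0 α (partialDeriv k (v s)) ≤ Torus.eContDiffHolderNorm 1 α (v s) :=
      fun k => Torus.eContDiffHolderNorm_partialDeriv_le (isContDiff_nat_of_isSmooth (hvs s hs) 1) k α
    calc μ s ≤ Torus.eContDiffHolderNorm 1 α (v s) + ∑ _k : Fin 3, Torus.eContDiffHolderNorm 1 α (v s) :=
          add_le_add h1 (Finset.sum_le_sum fun k _ => h2 k)
      _ = 4 * Torus.eContDiffHolderNorm 1 α (v s) := by
          simp only [Finset.sum_const, Finset.card_univ, Fintype.card_fin, nsmul_eq_mul]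
          push_cast
          ring
  set B : ℝ≥0∞ := ENNReal.ofReal (8 * U) with hB
  have hμ₀ : μ t₀ ≤ ENNReal.ofReal (4 * U) := by
    refine (hF2 t₀ ht₀).trans ?_
    rw [ENNReal.ofReal_mul (by norm_num), ENNReal.ofReal_ofNat]
    exact mul_le_mul' le_rfl hvU
  have h0 : μ t₀ ≤ B := hμ₀.trans (ENNReal.ofReal_le_ofReal (by linarith))
  have h2B : 2 * B = ENNReal.ofReal (16 * U) := by
    rw [hB, ← ENNReal.ofReal_ofNat 2, ← ENNReal.ofReal_mul (by norm_num)]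
    congr 1
    ring
  -- finiteness of the `C^{1,α}` norms (for the propagation step)
  obtain ⟨Mf, hMf0, hMf⟩ := exists_forall_eContDiffHolderNorm_le_of_Icc hab 1 hα1.le h.smooth_velocity
  set M' : ℝ := Mf + 1 with hM'
  have hM'0 : 0 < M' := by linarith
  have hvM' : ∀ s ∈ Icc a b, Torus.eContDiffHolderNorm 1 α (v s) ≤ ENNReal.ofReal M' := fun s hs =>
    (hMf s hs).trans (ENNReal.ofReal_le_ofReal (by linarith))
  set ε : ℝ := min (1 / (8 * M')) (2 * U / (P * M' ^ 2 + 1)) with hεdef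
  have hε : 0 < ε := lt_min (by positivity) (by positivity)
  have hε1 : ε ≤ 1 / (8 * M') := min_le_left _ _
  have hε2 : ε ≤ 2 * U / (P * M' ^ 2 + 1) := min_le_right _ _
  -- restriction of the solution to subintervals
  have hres : ∀ {a' b' : ℝ}, a' < b' → Icc a' b' ⊆ Icc a b → IsExactEulerOn (Icc a' b') v p :=
    fun hab' hsub => Torus.IsEulerReynoldsOn.restrict h hsub (uniqueDiffOn_Icc hab')
  -- improvement
  have himp : ∀ a' b', Icc a' b' ⊆ Icc a b → t₀ ∈ Icc a' b' →
      (∀ s ∈ Icc a' b', μ s ≤ 2 * B) → ∀ s ∈ Icc a' b', μ s ≤ B := by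
    intro a' b' hsub ht₀' h2 s hs
    rcases eq_or_lt_of_le (ht₀'.1.trans ht₀'.2) with heq | hab'
    · have : s = t₀ := by
        have h1 : s ∈ Icc a' b' := hs
        rw [← heq, Icc_self, mem_singleton_iff] at h1 ht₀'
        rw [h1, ht₀']
      rw [this]
      exact h0
    have ha' : a ≤ a' := (hsub (left_mem_Icc.2 hab'.le)).1
    have hb' : b' ≤ b := (hsub (right_mem_Icc.2 hab'.le)).2
    have hW : ∀ s ∈ Icc a' b', Torus.eContDiffHolderNorm 1 α (v s) ≤ ENNReal.ofReal (16 * U) :=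
      fun s hs => (hF1 s (hsub hs)).trans (h2B ▸ h2 s hs)
    have hWL : 16 * U * (b' - a') ≤ 1 / 4 := by nlinarith
    have h := hstep hab' (hres hab' hsub) (by positivity : (0 : ℝ) ≤ 16 * U) hW hWL ht₀'
      (by positivity : (0 : ℝ) ≤ 4 * U) hμ₀ s hs
    refine h.trans (ENNReal.ofReal_le_ofReal ?_)
    have hPc : 256 * P * ((b - a) * U) ≤ 2 := by
      calc 256 * P * ((b - a) * U) ≤ 256 * P * (1 / (128 * P + 1)) :=
            mul_le_mul_of_nonneg_left hc2 (by positivity)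
        _ ≤ 2 := by
            rw [mul_one_div, div_le_iff₀ (by positivity)]
            nlinarith
    have hk : (b' - a') * P * (16 * U) ^ 2 ≤ 2 * U := by
      have hba : (b' - a') * U ≤ (b - a) * U := mul_le_mul_of_nonneg_right (by linarith) hU.le
      calc (b' - a') * P * (16 * U) ^ 2 = U * (256 * P * ((b' - a') * U)) := by ring
        _ ≤ U * (256 * P * ((b - a) * U)) :=
            mul_le_mul_of_nonneg_left (mul_le_mul_of_nonneg_left hba (by positivity)) hU.le
        _ ≤ U * 2 := mul_le_mul_of_nonneg_left hPc hU.le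
        _ = 2 * U := by ring
    linarith
  -- propagation
  have hprop : ∀ s₀ ∈ Icc a b, μ s₀ ≤ B → ∀ s ∈ Icc a b, |s - s₀| ≤ ε → μ s ≤ 2 * B := by
    intro s₀ hs₀ hμs₀ s hs hss₀
    set a' := max a (s₀ - ε) with ha'
    set b' := min b (s₀ + ε) with hb'
    have hsub : Icc a' b' ⊆ Icc a b := fun x hx =>
      ⟨(le_max_left _ _).trans hx.1, hx.2.trans (min_le_left _ _)⟩
    have hs₀' : s₀ ∈ Icc a' b' := ⟨max_le hs₀.1 (by linarith), le_min hs₀.2 (by linarith)⟩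
    have hs' : s ∈ Icc a' b' := by
      rw [abs_sub_le_iff] at hss₀
      exact ⟨max_le hs.1 (by linarith [hss₀.2]), le_min hs.2 (by linarith [hss₀.1])⟩
    rcases eq_or_lt_of_le (hs₀'.1.trans hs₀'.2) with heq | hab'
    · have : s = s₀ := by
        rw [← heq, Icc_self, mem_singleton_iff] at hs' hs₀'
        rw [hs', hs₀']
      rw [this]
      exact hμs₀.trans (by
        calc B = 1 * B := (one_mul B).symm
          _ ≤ 2 * B := mul_le_mul' (by norm_num) le_rfl)
    have hlen : b' - a' ≤ 2 * ε := by
      have h1 : b' ≤ s₀ + ε := min_le_right _ _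
      have h2 : s₀ - ε ≤ a' := le_max_right _ _
      linarith
    have hWL : M' * (b' - a') ≤ 1 / 4 := by
      calc M' * (b' - a') ≤ M' * (2 * ε) := mul_le_mul_of_nonneg_left hlen hM'0.le
        _ ≤ M' * (2 * (1 / (8 * M'))) := by gcongr
        _ = 1 / 4 := by field_simp; ring
    have h := hstep hab' (hres hab' hsub) hM'0.le (fun s hs => hvM' s (hsub hs)) hWL hs₀'
      (by positivity : (0 : ℝ) ≤ 8 * U) hμs₀ s hs'
    rw [h2B]
    refine h.trans (ENNReal.ofReal_le_ofReal ?_)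
    have hεP : (b' - a') * P * M' ^ 2 ≤ 4 * U := by
      calc (b' - a') * P * M' ^ 2 ≤ (2 * ε) * P * M' ^ 2 := by gcongr
        _ = 2 * (ε * (P * M' ^ 2)) := by ring
        _ ≤ 2 * (2 * U / (P * M' ^ 2 + 1) * (P * M' ^ 2)) := by gcongr
        _ ≤ 2 * (2 * U) := by
            refine mul_le_mul_of_nonneg_left ?_ (by norm_num)
            rw [div_mul_eq_mul_div, div_le_iff₀ (by positivity)]
            nlinarith
        _ = 4 * U := by ring
    linarith
  -- conclude
  have hall := bootstrap_Icc ht₀ hε h0 himp hprop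
  intro t ht
  exact (hF1 t ht).trans (hall t ht)

end LevelOne

/-! ## All levels: induction with the level-`N` transport estimate -/

section AllLevels

/-- The induction step of `BDSV.holderCZBound.eulerApriori`: bounds for the levels `≤ N̄`
(`N̄ ≥ 1`) give bounds for the levels `≤ N̄ + 1` (the level-`N̄+1` transport estimate for
`∂ₜv + (v·∇)v = -∇p`, the pressure bound, and absorption of the top-order norm).
[cite: BuckmasterEtAl2018, Prop. 3.1 (3.2) and Cor. 3.2] -/
theorem holderCZBound.eulerApriori_succ (hCZ : holderCZBound) {α : ℝ≥0} (hα : 0 < α) (hα1 : α < 1)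
    {Nbar : ℕ} (hNbar : 0 < Nbar) {c C : ℝ} (hc0 : 0 < c) (hC1 : 1 ≤ C)
    (hIH : ∀ {a b : ℝ} (_ : a < b)
      {v : ℝ → UnitAddTorus (Fin 3) → EuclideanSpace ℝ (Fin 3)} {p : ℝ → UnitAddTorus (Fin 3) → ℝ}
      (_ : IsExactEulerOn (Icc a b) v p) {t₀ : ℝ} (_ : t₀ ∈ Icc a b) {U Λ : ℝ} (_ : 0 < U) (_ : 1 ≤ Λ)
      (_ : ∀ N, 1 ≤ N → N ≤ Nbar →
        Torus.eContDiffHolderNorm N α (v t₀) ≤ ENNReal.ofReal (U * Λ ^ (N - 1)))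
      (_ : (b - a) * U ≤ c),
      ∀ t ∈ Icc a b, ∀ N, 1 ≤ N → N ≤ Nbar →
        Torus.eContDiffHolderNorm N α (v t) ≤ ENNReal.ofReal (C * U * Λ ^ (N - 1))) :
    ∃ c' : ℝ, 0 < c' ∧ ∃ C' : ℝ, 1 ≤ C' ∧ ∀ {a b : ℝ} (_ : a < b)
      {v : ℝ → UnitAddTorus (Fin 3) → EuclideanSpace ℝ (Fin 3)} {p : ℝ → UnitAddTorus (Fin 3) → ℝ}
      (_ : IsExactEulerOn (Icc a b) v p) {t₀ : ℝ} (_ : t₀ ∈ Icc a b) {U Λ : ℝ} (_ : 0 < U) (_ : 1 ≤ Λ)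
      (_ : ∀ N, 1 ≤ N → N ≤ Nbar + 1 →
        Torus.eContDiffHolderNorm N α (v t₀) ≤ ENNReal.ofReal (U * Λ ^ (N - 1)))
      (_ : (b - a) * U ≤ c'),
      ∀ t ∈ Icc a b, ∀ N, 1 ≤ N → N ≤ Nbar + 1 →
        Torus.eContDiffHolderNorm N α (v t) ≤ ENNReal.ofReal (C' * U * Λ ^ (N - 1)) := by
  -- the level `N = Nbar + 1 ≥ 2`
  set N := Nbar + 1 with hNdef
  obtain ⟨A, hA1, hTN⟩ := eContDiffHolderNorm_transport_higher (d := Fin 3)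
    (F := EuclideanSpace ℝ (Fin 3)) N
  obtain ⟨CP, hCP⟩ := hCZ.gradient_pressure_le hα hα1 (N - 1)
  have hC0 : 0 < C := by linarith
  have hA0 : 0 < A := by linarith
  obtain ⟨Q, hQdef⟩ : ∃ Q : ℝ, Q = (CP : ℝ) * N + N := ⟨_, rfl⟩
  have hQ0 : 0 ≤ Q := by rw [hQdef]; positivity
  have hQ1 : 0 < 2 * A * C * Q + 1 := by
    have := mul_nonneg (mul_nonneg (mul_nonneg (by norm_num : (0 : ℝ) ≤ 2) hA0.le) hC0.le) hQ0
    linarith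
  have hQ2 : 0 < C ^ 2 * Q + 1 := by
    have := mul_nonneg (sq_nonneg C) hQ0
    linarith
  obtain ⟨c', hc'def⟩ : ∃ c' : ℝ, c' = min c (min (1 / (2 * C)) (min (1 / (C * A))
    (min (1 / (2 * A * C * Q + 1)) (1 / (C ^ 2 * Q + 1))))) := ⟨_, rfl⟩
  have hc'0 : 0 < c' := by
    rw [hc'def]
    exact lt_min hc0 (lt_min (by positivity) (lt_min (by positivity)
      (lt_min (one_div_pos.2 hQ1) (one_div_pos.2 hQ2))))
  have hc'c : c' ≤ c := by rw [hc'def]; exact min_le_left _ _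
  have hc'1 : c' ≤ 1 / (2 * C) := by rw [hc'def]; exact (min_le_right _ _).trans (min_le_left _ _)
  have hc'2 : c' ≤ 1 / (C * A) := by
    rw [hc'def]; exact (min_le_right _ _).trans ((min_le_right _ _).trans (min_le_left _ _))
  have hc'3 : c' ≤ 1 / (2 * A * C * Q + 1) := by
    rw [hc'def]
    exact (min_le_right _ _).trans ((min_le_right _ _).trans ((min_le_right _ _).trans (min_le_left _ _)))
  have hc'4 : c' ≤ 1 / (C ^ 2 * Q + 1) := by
    rw [hc'def]
    exact (min_le_right _ _).trans ((min_le_right _ _).trans ((min_le_right _ _).trans (min_le_right _ _)))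
  refine ⟨c', hc'0, max C (4 * A), le_max_of_le_left hC1, ?_⟩
  intro a b hab v p h t₀ ht₀ U Λ hU hΛ hdat hc t ht
  have hL : 0 < b - a := sub_pos.2 hab
  set L := b - a with hLdef
  have hLU : L * U ≤ c' := hc
  have hU0 : 0 ≤ U := hU.le
  have hΛ0 : 0 ≤ Λ := zero_le_one.trans hΛ
  have hvs : ∀ s ∈ Icc a b, IsSmooth (v s) := fun s hs => h.smooth_velocity.isSmooth_slice hs
  -- levels `≤ Nbar` from the induction hypothesis
  have hlow : ∀ s ∈ Icc a b, ∀ j, 1 ≤ j → j ≤ Nbar →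
      Torus.eContDiffHolderNorm j α (v s) ≤ ENNReal.ofReal (C * U * Λ ^ (j - 1)) :=
    fun s hs j hj hjN => hIH hab h ht₀ hU hΛ (fun N' h1 h2 => hdat N' h1 (h2.trans (Nat.le_succ _)))
      (hLU.trans hc'c) s hs j hj hjN
  have hone : ∀ s ∈ Icc a b, Torus.eContDiffHolderNorm 1 α (v s) ≤ ENNReal.ofReal (C * U) := by
    intro s hs
    have h := hlow s hs 1 le_rfl hNbar
    rwa [Nat.sub_self, pow_zero, mul_one] at h
  -- the top level: finiteness and the supremum `M`
  obtain ⟨Bfin, hBfin0, hBfin⟩ := exists_forall_eContDiffHolderNorm_le_of_Icc hab N hα1.le h.smooth_velocity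
  set S := ⨆ s ∈ Icc a b, Torus.eContDiffHolderNorm N α (v s) with hSdef
  have hSle : S ≤ ENNReal.ofReal Bfin := iSup₂_le fun s hs => hBfin s hs
  have hST : S ≠ ⊤ := ne_top_of_le_ne_top ENNReal.ofReal_ne_top hSle
  obtain ⟨M, hMdef⟩ : ∃ M : ℝ, M = S.toReal := ⟨_, rfl⟩
  have hM0 : 0 ≤ M := by rw [hMdef]; exact ENNReal.toReal_nonneg
  have hMS : ENNReal.ofReal M = S := by rw [hMdef, ENNReal.ofReal_toReal hST]
  have hvM : ∀ s ∈ Icc a b, Torus.eContDiffHolderNorm N α (v s) ≤ ENNReal.ofReal M := by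
    intro s hs
    rw [hMS]
    exact le_iSup₂ (f := fun s _ => Torus.eContDiffHolderNorm N α (v s)) s hs
  -- data for the level-`N` transport estimate
  have hCU : 0 ≤ C * U := by positivity
  have hK : ∀ s ∈ Icc a b, ∀ x, ‖Torus.fderiv (v s) x‖ ≤ (⟨C * U, hCU⟩ : ℝ≥0) :=
    fun s hs x => norm_fderiv_le_of_eContDiffHolderNorm_one_le hCU (hone s hs) x
  have hKL : ((⟨C * U, hCU⟩ : ℝ≥0) : ℝ) * (b - a) ≤ 1 / 2 := by
    change C * U * L ≤ 1 / 2
    calc C * U * L = C * (L * U) := by ring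
      _ ≤ C * (1 / (2 * C)) := mul_le_mul_of_nonneg_left (hLU.trans hc'1) hC0.le
      _ = 1 / 2 := by field_simp
  set V : ℕ → ℝ := fun j => if j ≤ Nbar then C * U * Λ ^ (j - 1) else M with hVdef
  have hV0 : ∀ j, 0 ≤ V j := fun j => by
    simp only [hVdef]
    split_ifs
    · positivity
    · exact hM0
  have hV1 : V 1 = C * U := by
    have h1 : (1 : ℕ) ≤ Nbar := hNbar
    simp only [hVdef, h1, if_true, Nat.sub_self, pow_zero, mul_one]
  have hV : ∀ s ∈ Icc a b, ∀ j, 1 ≤ j → j ≤ N →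
      Torus.eContDiffHolderNorm j α (v s) ≤ ENNReal.ofReal (V j) := by
    intro s hs j hj hjN
    by_cases hjb : j ≤ Nbar
    · simp only [hVdef, hjb, if_true]
      exact hlow s hs j hj hjb
    · have hjeq : j = N := by omega
      simp only [hVdef, hjb, if_false]
      rw [hjeq]
      exact hvM s hs
  have hsmall : (b - a) * V 1 * A ≤ 1 := by
    rw [hV1]
    calc L * (C * U) * A = (C * A) * (L * U) := by ring
      _ ≤ (C * A) * (1 / (C * A)) := mul_le_mul_of_nonneg_left (hLU.trans hc'2) (by positivity)
      _ = 1 := by field_simp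
  set G : ℝ → UnitAddTorus (Fin 3) → EuclideanSpace ℝ (Fin 3) := fun s x => -gradient (p s) x with hGdef
  have hG : IsSmoothSpaceTimeOn (Icc a b) G := (h.smooth_pressure.gradient (uniqueDiffOn_Icc hab)).neg
  have heq := IsExactEulerOn.transport_eq h
  set Φ : ℕ → ℝ := fun m => C * U * Λ ^ (m - 1) with hΦdef
  have hΦ0 : ∀ m, 0 ≤ Φ m := fun m => by positivity
  have hΦ : ∀ s ∈ Icc a b, ∀ m, 1 ≤ m → m < N →
      Torus.eContDiffHolderNorm m α (v s) ≤ ENNReal.ofReal (Φ m) :=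
    fun s hs m hm hmN => hlow s hs m hm (Nat.lt_succ_iff.1 hmN)
  have hF₀ : Torus.eContDiffHolderNorm N α (v t₀) ≤ ENNReal.ofReal (U * Λ ^ (N - 1)) :=
    hdat N (Nat.le_add_left 1 Nbar) le_rfl
  -- the uniform bound for products of two norms of complementary orders
  obtain ⟨T, hTdef⟩ : ∃ T : ℝ, T = C * U * M + C ^ 2 * U ^ 2 * Λ ^ (N - 1) := ⟨_, rfl⟩
  have hT0 : 0 ≤ T := by rw [hTdef]; positivity
  have hT1 : C * U * M ≤ T := by rw [hTdef]; exact le_add_of_nonneg_right (by positivity)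
  have hT2 : C ^ 2 * U ^ 2 * Λ ^ (N - 1) ≤ T := by rw [hTdef]; exact le_add_of_nonneg_left (by positivity)
  have hpair : ∀ s ∈ Icc a b, ∀ i j, 1 ≤ i → 1 ≤ j → i + j = N + 1 →
      Torus.eContDiffHolderNorm i α (v s) * Torus.eContDiffHolderNorm j α (v s) ≤ ENNReal.ofReal T := by
    intro s hs i j hi hj hij
    by_cases hib : i ≤ Nbar
    · by_cases hjb : j ≤ Nbar
      · -- both below the top level
        calc _ ≤ ENNReal.ofReal (C * U * Λ ^ (i - 1)) * ENNReal.ofReal (C * U * Λ ^ (j - 1)) :=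
              mul_le_mul' (hlow s hs i hi hib) (hlow s hs j hj hjb)
          _ = ENNReal.ofReal (C ^ 2 * U ^ 2 * Λ ^ (N - 1)) := by
              rw [← ENNReal.ofReal_mul (by positivity)]
              congr 1
              have hpow : Λ ^ (i - 1) * Λ ^ (j - 1) = Λ ^ (N - 1) := by
                rw [← pow_add]; congr 1; omega
              calc C * U * Λ ^ (i - 1) * (C * U * Λ ^ (j - 1))
                  = C ^ 2 * U ^ 2 * (Λ ^ (i - 1) * Λ ^ (j - 1)) := by ring
                _ = _ := by rw [hpow]
          _ ≤ ENNReal.ofReal T := ENNReal.ofReal_le_ofReal hT2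
      · -- `j` is the top level, `i = 1`
        have hjeq : j = N := by omega
        have hieq : i = 1 := by omega
        subst hjeq; subst hieq
        calc _ ≤ ENNReal.ofReal (C * U) * ENNReal.ofReal M := mul_le_mul' (hone s hs) (hvM s hs)
          _ = ENNReal.ofReal (C * U * M) := by rw [← ENNReal.ofReal_mul hCU]
          _ ≤ ENNReal.ofReal T := ENNReal.ofReal_le_ofReal hT1
    · have hieq : i = N := by omega
      have hjeq : j = 1 := by omega
      subst hieq; subst hjeq
      calc _ ≤ ENNReal.ofReal M * ENNReal.ofReal (C * U) := mul_le_mul' (hvM s hs) (hone s hs)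
        _ = ENNReal.ofReal (C * U * M) := by rw [← ENNReal.ofReal_mul hM0]; congr 1; ring
        _ ≤ ENNReal.ofReal T := ENNReal.ofReal_le_ofReal hT1
  -- the forcing bound
  have hCPN : (0 : ℝ) ≤ CP * N := by positivity
  have hGb : ∀ s ∈ Icc a b, Torus.eContDiffHolderNorm N α (G s) ≤ ENNReal.ofReal (CP * N * T) := by
    intro s hs
    have hGs : G s = -gradient (p s) := rfl
    rw [hGs, Torus.eContDiffHolderNorm_neg]
    have h := hCP hab h s hs
    rw [show N - 1 + 1 = N from Nat.succ_pred_eq_of_pos (Nat.succ_pos _)] at h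
    refine h.trans ?_
    calc (CP : ℝ≥0∞) * ∑ m ∈ Finset.range N, Torus.eContDiffHolderNorm (m + 1) α (v s) *
          Torus.eContDiffHolderNorm (N - 1 - m + 1) α (v s)
        ≤ (CP : ℝ≥0∞) * ∑ _m ∈ Finset.range N, ENNReal.ofReal T := by
          refine mul_le_mul' le_rfl (Finset.sum_le_sum fun m hm => ?_)
          have hmN : m < N := Finset.mem_range.1 hm
          exact hpair s hs (m + 1) (N - 1 - m + 1) (Nat.le_add_left 1 m) (Nat.le_add_left 1 _) (by omega)
      _ = ENNReal.ofReal (CP * N * T) := by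
          rw [Finset.sum_const, Finset.card_range, nsmul_eq_mul, ENNReal.ofReal_mul hCPN,
            ENNReal.ofReal_mul (NNReal.coe_nonneg CP), ENNReal.ofReal_coe_nnreal, ENNReal.ofReal_natCast]
          ring
  -- apply the level-`N` transport estimate
  have hTN' := hTN hab hα1.le h.smooth_velocity hK hKL hV0 ht₀ hV hsmall h.smooth_velocity hG heq hΦ0 hΦ
    (by positivity : (0 : ℝ) ≤ U * Λ ^ (N - 1)) (mul_nonneg hCPN hT0) hF₀ hGb
  -- the lower-order sum
  have hlowsum : ∑ i ∈ Finset.range (N - 1), V (i + 2) * Φ (N - 1 - i) ≤ (N - 1 : ℕ) * T := by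
    calc ∑ i ∈ Finset.range (N - 1), V (i + 2) * Φ (N - 1 - i) ≤ ∑ _i ∈ Finset.range (N - 1), T := by
          refine Finset.sum_le_sum fun i hi => ?_
          have hiN : i < N - 1 := Finset.mem_range.1 hi
          simp only [hVdef, hΦdef]
          split_ifs with hib
          · have hpow : Λ ^ (i + 2 - 1) * Λ ^ (N - 1 - i - 1) = Λ ^ (N - 1) := by
              rw [← pow_add]; congr 1; omega
            calc C * U * Λ ^ (i + 2 - 1) * (C * U * Λ ^ (N - 1 - i - 1))
                = C ^ 2 * U ^ 2 * (Λ ^ (i + 2 - 1) * Λ ^ (N - 1 - i - 1)) := by ring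
              _ = C ^ 2 * U ^ 2 * Λ ^ (N - 1) := by rw [hpow]
              _ ≤ T := hT2
          · have hi2 : N - 1 - i - 1 = 0 := by omega
            rw [hi2, pow_zero, mul_one]
            calc M * (C * U) = C * U * M := by ring
              _ ≤ T := hT1
      _ = (N - 1 : ℕ) * T := by rw [Finset.sum_const, Finset.card_range, nsmul_eq_mul]
  -- the bound `X` for the top norms and absorption
  have hN1 : (0 : ℝ) ≤ ((N - 1 : ℕ) : ℝ) := Nat.cast_nonneg _
  obtain ⟨X, hXdef⟩ : ∃ X : ℝ, X = A * (U * Λ ^ (N - 1) + L * (CP * N * T) + L * ((N - 1 : ℕ) * T)) :=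
    ⟨_, rfl⟩
  have hX0 : 0 ≤ X := by
    rw [hXdef]
    exact mul_nonneg hA0.le (add_nonneg (add_nonneg (by positivity) (mul_nonneg hL.le
      (mul_nonneg hCPN hT0))) (mul_nonneg hL.le (mul_nonneg hN1 hT0)))
  have hvX : ∀ s ∈ Icc a b, Torus.eContDiffHolderNorm N α (v s) ≤ ENNReal.ofReal X := fun s hs => by
    rw [hXdef]
    exact (hTN' s hs).trans (ENNReal.ofReal_le_ofReal (mul_le_mul_of_nonneg_left
      (add_le_add le_rfl (mul_le_mul_of_nonneg_left hlowsum hL.le)) hA0.le))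
  have hMX : M ≤ X := by
    have h1 : S ≤ ENNReal.ofReal X := iSup₂_le fun s hs => hvX s hs
    rw [← hMS] at h1
    exact (ENNReal.ofReal_le_ofReal_iff hX0).1 h1
  -- `X = X' + θ M` with `θ ≤ 1/2`
  have hNQ : (CP : ℝ) * N + ((N - 1 : ℕ) : ℝ) ≤ Q := by
    rw [hQdef]
    have : ((N - 1 : ℕ) : ℝ) ≤ N := by exact_mod_cast Nat.sub_le N 1
    linarith
  have hR0 : (0 : ℝ) ≤ CP * N + ((N - 1 : ℕ) : ℝ) := add_nonneg hCPN hN1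
  have hθ : A * L * (CP * N + (N - 1 : ℕ)) * (C * U) ≤ 1 / 2 := by
    have h1 : A * C * (CP * N + (N - 1 : ℕ)) ≤ A * C * Q := mul_le_mul_of_nonneg_left hNQ (by positivity)
    have h2 : (A * C * Q) * (1 / (2 * A * C * Q + 1)) ≤ 1 / 2 := by
      rw [mul_one_div, div_le_iff₀ hQ1]
      linarith
    calc A * L * (CP * N + (N - 1 : ℕ)) * (C * U) = (A * C * (CP * N + (N - 1 : ℕ))) * (L * U) := by ring
      _ ≤ (A * C * Q) * c' := mul_le_mul h1 hLU (mul_nonneg hL.le hU0)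
          (mul_nonneg (mul_nonneg hA0.le hC0.le) hQ0)
      _ ≤ (A * C * Q) * (1 / (2 * A * C * Q + 1)) :=
          mul_le_mul_of_nonneg_left hc'3 (mul_nonneg (mul_nonneg hA0.le hC0.le) hQ0)
      _ ≤ 1 / 2 := h2
  have hlow2 : L * (CP * N + (N - 1 : ℕ)) * (C ^ 2 * U ^ 2) ≤ U := by
    have h1 : C ^ 2 * (CP * N + (N - 1 : ℕ)) ≤ C ^ 2 * Q := mul_le_mul_of_nonneg_left hNQ (sq_nonneg C)
    have h2 : (C ^ 2 * Q) * (1 / (C ^ 2 * Q + 1)) ≤ 1 := by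
      rw [mul_one_div, div_le_iff₀ hQ2]
      linarith
    calc L * (CP * N + (N - 1 : ℕ)) * (C ^ 2 * U ^ 2)
        = (C ^ 2 * (CP * N + (N - 1 : ℕ))) * (L * U) * U := by ring
      _ ≤ (C ^ 2 * Q) * c' * U :=
          mul_le_mul_of_nonneg_right (mul_le_mul h1 hLU (mul_nonneg hL.le hU0)
            (mul_nonneg (sq_nonneg C) hQ0)) hU0
      _ ≤ (C ^ 2 * Q) * (1 / (C ^ 2 * Q + 1)) * U :=
          mul_le_mul_of_nonneg_right (mul_le_mul_of_nonneg_left hc'4 (mul_nonneg (sq_nonneg C) hQ0)) hU0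
      _ ≤ 1 * U := mul_le_mul_of_nonneg_right h2 hU0
      _ = U := one_mul U
  have hXsplit : X = A * (U * Λ ^ (N - 1) + L * (CP * N + (N - 1 : ℕ)) * (C ^ 2 * U ^ 2) * Λ ^ (N - 1)) +
      (A * L * (CP * N + (N - 1 : ℕ)) * (C * U)) * M := by
    rw [hXdef, hTdef]
    ring
  have hM2 : M ≤ 4 * A * U * Λ ^ (N - 1) := by
    have hΛN : 0 ≤ Λ ^ (N - 1) := by positivity
    have h3 : L * (CP * N + (N - 1 : ℕ)) * (C ^ 2 * U ^ 2) * Λ ^ (N - 1) ≤ U * Λ ^ (N - 1) :=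
      mul_le_mul_of_nonneg_right hlow2 hΛN
    have h4 : (A * L * (CP * N + (N - 1 : ℕ)) * (C * U)) * M ≤ (1 / 2) * M :=
      mul_le_mul_of_nonneg_right hθ hM0
    have h5 : A * (U * Λ ^ (N - 1) + L * (CP * N + (N - 1 : ℕ)) * (C ^ 2 * U ^ 2) * Λ ^ (N - 1)) ≤
        2 * A * U * Λ ^ (N - 1) := by
      have h6 := mul_le_mul_of_nonneg_left (add_le_add (le_refl (U * Λ ^ (N - 1))) h3) hA0.le
      calc _ ≤ A * (U * Λ ^ (N - 1) + U * Λ ^ (N - 1)) := h6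
        _ = 2 * A * U * Λ ^ (N - 1) := by ring
    have h1 : M ≤ 2 * A * U * Λ ^ (N - 1) + (1 / 2) * M :=
      calc M ≤ X := hMX
        _ = _ := hXsplit
        _ ≤ 2 * A * U * Λ ^ (N - 1) + (1 / 2) * M := add_le_add h5 h4
    linarith
  -- conclude
  intro N' hN'1 hN'N
  by_cases hb : N' ≤ Nbar
  · refine (hlow t ht N' hN'1 hb).trans (ENNReal.ofReal_le_ofReal ?_)
    exact mul_le_mul_of_nonneg_right (mul_le_mul_of_nonneg_right (le_max_left _ _) hU0) (by positivity)
  · have hN'eq : N' = N := by omega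
    rw [hN'eq]
    refine (hvM t ht).trans (ENNReal.ofReal_le_ofReal (hM2.trans ?_))
    have hmax : 4 * A ≤ max C (4 * A) := le_max_right _ _
    exact mul_le_mul_of_nonneg_right (mul_le_mul_of_nonneg_right hmax hU0) (by positivity)


/-- **A priori Hölder bounds for exact Euler solutions, all orders** (BDSV Prop. 3.1 (3.2) and
Cor. 3.2, for every smooth exact Euler solution, dimensionless form): from `BDSV.holderCZBound`,
`0 < α < 1` and `N̄` there are `c > 0` and `C ≥ 1` such that for a smooth exact Euler solution
`(v, p)` on `[a,b] × T³`, `t₀ ∈ [a,b]`, `U > 0`, `Λ ≥ 1` with `‖v(t₀)‖_{N,α} ≤ U Λ^{N-1}` for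
`1 ≤ N ≤ N̄` and `(b - a) U ≤ c`: `‖v(t)‖_{N,α} ≤ C U Λ^{N-1}` for all `t ∈ [a,b]` and
`1 ≤ N ≤ N̄` (level `1` by `BDSV.holderCZBound.eulerApriori_one`; level `N ≥ 2` by the level-`N`
transport estimate for `∂ₜv + (v·∇)v = -∇p`, the pressure bound, and absorption of the top-order
norm, which enters linearly). [cite: BuckmasterEtAl2018, Prop. 3.1 (3.2) and Cor. 3.2] -/
theorem holderCZBound.eulerApriori (hCZ : holderCZBound) {α : ℝ≥0} (hα : 0 < α) (hα1 : α < 1)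
    (Nbar : ℕ) :
    ∃ c : ℝ, 0 < c ∧ ∃ C : ℝ, 1 ≤ C ∧ ∀ {a b : ℝ} (_ : a < b)
      {v : ℝ → UnitAddTorus (Fin 3) → EuclideanSpace ℝ (Fin 3)} {p : ℝ → UnitAddTorus (Fin 3) → ℝ}
      (_ : IsExactEulerOn (Icc a b) v p) {t₀ : ℝ} (_ : t₀ ∈ Icc a b) {U Λ : ℝ} (_ : 0 < U) (_ : 1 ≤ Λ)
      (_ : ∀ N, 1 ≤ N → N ≤ Nbar →
        Torus.eContDiffHolderNorm N α (v t₀) ≤ ENNReal.ofReal (U * Λ ^ (N - 1)))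
      (_ : (b - a) * U ≤ c),
      ∀ t ∈ Icc a b, ∀ N, 1 ≤ N → N ≤ Nbar →
        Torus.eContDiffHolderNorm N α (v t) ≤ ENNReal.ofReal (C * U * Λ ^ (N - 1)) := by
  induction Nbar with
  | zero =>
    refine ⟨1, one_pos, 1, le_rfl, ?_⟩
    intro a b _ v p _ t₀ _ U Λ _ _ _ _ t _ N h1 h2
    omega
  | succ Nbar IH =>
    obtain ⟨c, hc0, C, hC1, hIH⟩ := IH
    rcases Nat.eq_zero_or_pos Nbar with hNbar | hNbar
    · -- only the level `1`
      subst hNbar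
      obtain ⟨c₁, hc₁, hone⟩ := hCZ.eulerApriori_one hα hα1
      refine ⟨c₁, hc₁, 8, by norm_num, ?_⟩
      intro a b hab v p h t₀ ht₀ U Λ hU hΛ hdat hc t ht N h1 h2
      have hN : N = 1 := by omega
      subst hN
      have hd := hdat 1 le_rfl le_rfl
      rw [Nat.sub_self, pow_zero, mul_one] at hd
      have h := hone hab h ht₀ hU hd hc t ht
      rwa [Nat.sub_self, pow_zero, mul_one]
    exact hCZ.eulerApriori_succ hα hα1 hNbar hc0 hC1 hIH

end AllLevels

end BDSV

end Literature.Analysis.FluidPDE
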